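import Mathlib

/-!
# `FeketeSOS.CharPSparseSOS`, line `Sketch-ideator5` — stub `stub_fourthMomentExpand`

Fourth-moment expansion (elementary).  For a prime `p`, `χ_p = legendreSym p` and a finite set
`Q ⊆ ℕ` put `Λ_Q(x) = Σ_{a ∈ Q} χ_p(x + a)`.  Then
`Σ_{x < p} Λ_Q(x)⁴ = Σ_{((a,b),(c,d)) ∈ (Q × Q) × (Q × Q)} Σ_{x < p} χ_p((x+a)(x+b)(x+c)(x+d))`:
expand the fourth power of the sum as a sum over quadruples, use multiplicativity of the
Legendre symbol, and swap the two summations.  Mathlib only.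
-/

-- `Summit.ValiantsHypothesis.ValiantsHypothesis.…` is the tree's mandated single-conjunct layout (Sub = Summit).
set_option linter.dupNamespace false

namespace Summit.ValiantsHypothesis.ValiantsHypothesis.Theorems.CharPSparseSOSTraceBias

open Finset

/-- Product of two finite sums as a single sum over the product set. -/
theorem fm_sum_mul_sum_product {ι κ R : Type*} [CommSemiring R] (s : Finset ι) (t : Finset κ)
    (f : ι → R) (g : κ → R) :
    (∑ a ∈ s, f a) * (∑ b ∈ t, g b) = ∑ u ∈ s ×ˢ t, f u.1 * g u.2 := by
  rw [Finset.sum_product, Finset.sum_mul_sum]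

/-- Fourth power of a finite sum as a sum over `(s ×ˢ s) ×ˢ (s ×ˢ s)`. -/
theorem fm_pow_four_sum {ι R : Type*} [CommSemiring R] (s : Finset ι) (f : ι → R) :
    (∑ a ∈ s, f a) ^ 4 =
      ∑ t ∈ (s ×ˢ s) ×ˢ (s ×ˢ s), f t.1.1 * f t.1.2 * f t.2.1 * f t.2.2 := by
  have h4 : (∑ a ∈ s, f a) ^ 4 =
      ((∑ a ∈ s, f a) * (∑ a ∈ s, f a)) * ((∑ a ∈ s, f a) * (∑ a ∈ s, f a)) := by
    ring
  rw [h4, fm_sum_mul_sum_product s s f f, fm_sum_mul_sum_product]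
  refine Finset.sum_congr rfl fun t _ => ?_
  ring

/-- **Fourth-moment expansion.**  `Σ_{x<p} Λ_Q(x)⁴ = Σ_{((a,b),(c,d)) ∈ (Q×Q)×(Q×Q)} S_p(a,b,c,d)` with
`Λ_Q(x) = Σ_{a∈Q} χ_p(x+a)` and `S_p(a,b,c,d) = Σ_{x<p} χ_p((x+a)(x+b)(x+c)(x+d))`: expand the
fourth power (`fm_pow_four_sum`), use multiplicativity of `χ_p` (`legendreSym.mul`), and swap the
sums (`Finset.sum_comm`). -/
theorem stub_fourthMomentExpand :
    ∀ (p : ℕ) [Fact p.Prime] (Q : Finset ℕ),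
      (∑ x ∈ range p, (∑ a ∈ Q, legendreSym p ((x : ℤ) + a)) ^ 4) =
        ∑ t ∈ (Q ×ˢ Q) ×ˢ (Q ×ˢ Q), ∑ x ∈ range p, legendreSym p
          (((x : ℤ) + t.1.1) * ((x : ℤ) + t.1.2) * ((x : ℤ) + t.2.1) * ((x : ℤ) + t.2.2)) := by
  intro p _ Q
  rw [Finset.sum_comm]
  refine Finset.sum_congr rfl fun x _ => ?_
  rw [fm_pow_four_sum]
  refine Finset.sum_congr rfl fun t _ => ?_
  rw [legendreSym.mul, legendreSym.mul, legendreSym.mul]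

end Summit.ValiantsHypothesis.ValiantsHypothesis.Theorems.CharPSparseSOSTraceBias
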